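import Literature.Analysis.FunctionSpaces.TorusRieszTransform
import HarnessLib

/-!
# Second-order Riesz transforms on the flat torus with the Burkholder constant `p* − 1` (named facts)

Analysis/FunctionSpaces fact file (two NAMED FACTS, nothing asserted; their `p = 2` instance and the
`p = 4` unpackings used downstream are PROVED). Search for candidate a priori estimates; no regularity
claim — this file records two published sharp-constant results about the double Riesz transforms
`RⱼRₖ` (Fourier multipliers `-ξⱼξₖ/|ξ|²`) in the periodic vocabulary of the tree
(`Literature.Analysis.FunctionSpaces.Torus.partialDeriv/laplacian/IsSmooth` on `UnitAddTorus d`), as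
companions WITH EXPLICIT CONSTANT of the existence statement `Torus.eLpNorm_hessian_le_laplacian`
(`TorusRieszTransform`; proved in the tree for `card d ≤ 3`). Throughout
`p* − 1 := max {p − 1, (p − 1)⁻¹}` (`p* = max {p, p/(p−1)}`), Burkholder's UMD constant of `ℝ`.

1. `Torus.secondRiesz_hessian_le_laplacian_sharp` — the UPPER bound
   `‖∂ⱼ∂ₖ w‖_{L^p(T^d)} ≤ (p* − 1) ‖Δw‖_{L^p(T^d)}` for smooth real `w`, all `j, k`, `1 < p < ∞`.
   In print on `ℝ^d` (every `d`): `‖RⱼRₖ f‖_p ≤ (p* − 1)‖f‖_p` (`j ≠ k`) and `‖Rⱼ² f‖_p ≤ (p* − 1)‖f‖_p`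
   — Bañuelos–Méndez-Hernández 2003 (space-time Brownian motion + Burkholder's martingale transform
   inequality), restated as eqs. (4), (5) of Bañuelos–Bogdan 2007, who re-derive (5) (and
   `‖∑ⱼ aⱼRⱼ²‖_p ≤ p* − 1` for `|aⱼ| ≤ 1`, eq. (34)) from Lévy-process multipliers. Periodisation: for a
   multiplier homogeneous of degree `0` and smooth off the origin the `L^p(ℝ^d)` operator norm equals
   the `L^p(𝕋^d)` norm and the norm on mean-zero functions `L^p_0(𝕋^d)`
   (Geiss–Montgomery-Smith–Saksman 2010, Lemma 2.2 — de Leeuw's transference, Grafakos 2014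
   Thm. 4.3.7, plus the converse), and `∂ⱼ∂ₖw = -RⱼRₖ Δw` with `Δw` of mean zero (Grafakos 2014,
   Prop. 5.1.17); the unit period of `UnitAddTorus` instead of `2π` is a dilation, which does not change
   the norm of a `0`-homogeneous multiplier.
2. `Torus.secondRiesz_box_laplacian_lower_sharp` — the LOWER bound on `𝕋²`: the operator norm of
   `R₂² − R₁² = Re 𝔅` (real part of the Beurling–Ahlfors transform) on `L^p_0(𝕋²)` is AT LEAST `p* − 1`,
   unpacked on smooth test functions: for every `c < p* − 1` there is a smooth `ψ` on `𝕋²` with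
   `Δψ ≠ 0` in `L^p` and `c‖Δψ‖_p ≤ ‖(∂₀² − ∂₁²)ψ‖_p`. In print: `‖Re 𝔅‖_{L^p(ℝ²)→L^p(ℝ²)} = p* − 1`
   (Geiss–Montgomery-Smith–Saksman 2010, Cor. 1.1 — the lower bound is theirs, the upper bound
   Nazarov–Volberg), transferred to `L^p_0(𝕋²)` by their Lemma 2.2; the unpacking uses only that a
   bounded operator's norm on `L^p_0(𝕋²)` is the supremum over the dense mean-zero trigonometric
   polynomials, each of which is `Δψ` for a trigonometric polynomial `ψ`, and
   `(R₂² − R₁²)Δψ = (∂₁² − ∂₂²)ψ` (written `∂₀∂₀ψ − ∂₁∂₁ψ` in the tree's `Fin 2` indexing).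

PROVED here: the `p = 2` instance of fact 1 (constant `max {1, 1} = 1`; Parseval, from the tree's
`Torus.eLpNorm_hessian_le_laplacian_two`) as a check on the rendering; the `p = 4` corollary of fact 1
(`‖∂ⱼ∂ₖw‖₄ ≤ 3‖Δw‖₄`, the shape of the hypothesis `HessianL4Bound 3` of the NS functional-mining
cell); and the `p = 4` corollary of fact 2 in fourth-power integral form (`∀ c < 81, ∃ ψ smooth,
0 < ∫(Δψ)⁴ ∧ c∫(Δψ)⁴ ≤ ∫(□ψ)⁴`, the shape of the cell's hypothesis `SecondRieszQuarticLower 3`).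
Genuine martingale-transform / Bellman-function analysis, absent from Mathlib at this pin; hence named
facts (D-0014), never asserted.
-- TODO(general form): vector-valued (UMD-space) versions `‖(Id + 2R₁²) ⊗ Id_X‖ = umd_p(X)`
-- (GMS 2010, Thm. 1.1), the `ℝ^d` statements themselves, and the equality (not only `≤`) in fact 1.

## References

* [BanuelosMendezHernandez2003] R. Bañuelos, P. J. Méndez-Hernández, *Space-time Brownian motion and
  the Beurling–Ahlfors transform*, Indiana Univ. Math. J. 52 (2003) 981–990 — `‖RⱼRₖ‖_p, ‖Rⱼ²‖_p ≤ p* − 1`.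
* [BanuelosBogdan2007] R. Bañuelos, K. Bogdan, *Lévy processes and Fourier multipliers*, J. Funct.
  Anal. 250 (2007) 197–213 (arXiv:math/0609432) — eqs. (4), (5) p. 1; eq. (34) p. 11.
* [GeissMontgomerySmithSaksman2010] S. Geiss, S. Montgomery-Smith, E. Saksman, *On singular integral
  and martingale transforms*, Trans. AMS 362 (2010) 553–575 (arXiv:math/0701516) — Cor. 1.1, Lemma 2.2.
* [Grafakos2014] L. Grafakos, *Classical Fourier Analysis*, 3rd ed., GTM 249 — Thm. 4.3.7, Prop. 5.1.17.
-/

noncomputable section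

open MeasureTheory Set Filter Topology UnitAddTorus Function
open scoped ENNReal NNReal ContDiff

namespace Literature.Analysis.FunctionSpaces

namespace Torus

variable {d : Type*} [Fintype d]

/-! ## 1. The upper bound with the constant `p* − 1` -/

/-- **Sharp-constant Calderón–Zygmund bound for the Hessian on `T^d`** (named fact, nothing
asserted): for `1 < p < ∞`, every smooth real `w` on the flat torus and all coordinate directions
`j, k`, `‖∂ⱼ∂ₖ w‖_{L^p(T^d)} ≤ (p* − 1) ‖Δw‖_{L^p(T^d)}` with `p* − 1 = max {p − 1, (p − 1)⁻¹}`. In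
print on `ℝ^d`: `‖RⱼRₖf‖_p ≤ (p* − 1)‖f‖_p` (`j ≠ k`) and `‖Rⱼ²f‖_p ≤ (p* − 1)‖f‖_p`
(Bañuelos–Méndez-Hernández 2003; Bañuelos–Bogdan 2007, eqs. (4), (5), (34)); on the torus by the
equality of `L^p(ℝ^d)`, `L^p(𝕋^d)` and `L^p_0(𝕋^d)` operator norms of `0`-homogeneous multipliers
smooth off `0` (Geiss–Montgomery-Smith–Saksman 2010, Lemma 2.2; de Leeuw / Grafakos 2014 Thm. 4.3.7)
and `∂ⱼ∂ₖw = -RⱼRₖΔw`, `∫Δw = 0` (Grafakos 2014, Prop. 5.1.17). The existence-of-a-constant form is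
the tree's `Torus.eLpNorm_hessian_le_laplacian` (proved for `card d ≤ 3`); the case `p = 2` of the
present statement is `secondRiesz_hessian_le_laplacian_sharp_case_two` below (constant `1`).
[cite: BanuelosBogdan2007, eqs. (4), (5) (p. 1) and (34) (p. 11)]
[cite: BanuelosMendezHernandez2003, Thm. 1]
[cite: GeissMontgomerySmithSaksman2010, Lemma 2.2] [cite: Grafakos2014, Thm. 4.3.7, Prop. 5.1.17] -/
def secondRiesz_hessian_le_laplacian_sharp : Prop :=
  ∀ [DecidableEq d] (p : ℝ≥0∞), 1 < p → p < (⊤ : ℝ≥0∞) →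
    ∀ (w : UnitAddTorus d → ℝ), IsSmooth w → ∀ j k : d,
      eLpNorm (partialDeriv j (partialDeriv k w)) p volume ≤
        ENNReal.ofReal (max (p.toReal - 1) (p.toReal - 1)⁻¹) * eLpNorm (laplacian w) p volume

section Consequences

variable [DecidableEq d]

/-- The sharp fact holds at `p = 2` (there `p* − 1 = max {1, 1} = 1`; Parseval), a consistency check
of the rendering. [cite: BanuelosBogdan2007, eq. (5) (p. 1)] -/
theorem secondRiesz_hessian_le_laplacian_sharp_case_two (w : UnitAddTorus d → ℝ) (hw : IsSmooth w)
    (j k : d) :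
    eLpNorm (partialDeriv j (partialDeriv k w)) 2 volume ≤
      ENNReal.ofReal (max ((2 : ℝ≥0∞).toReal - 1) ((2 : ℝ≥0∞).toReal - 1)⁻¹) *
        eLpNorm (laplacian w) 2 volume := by
  have h : max ((2 : ℝ≥0∞).toReal - 1) ((2 : ℝ≥0∞).toReal - 1)⁻¹ = 1 := by norm_num
  rw [h, ENNReal.ofReal_one, one_mul]
  exact eLpNorm_hessian_le_laplacian_two hw j k

/-- **The `L⁴` instance: `‖∂ⱼ∂ₖw‖_{L⁴(T^d)} ≤ 3‖Δw‖_{L⁴(T^d)}`** (`p* − 1 = 3` at `p = 4`) — the shape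
of the hypothesis `HessianL4Bound 3` of the NS functional-mining cell (take `d = Fin 3`).
[cite: BanuelosBogdan2007, eqs. (4), (5) (p. 1)] -/
theorem secondRiesz_hessian_le_laplacian_sharp.four (h : secondRiesz_hessian_le_laplacian_sharp (d := d))
    (w : UnitAddTorus d → ℝ) (hw : IsSmooth w) (j k : d) :
    eLpNorm (partialDeriv j (partialDeriv k w)) 4 volume ≤
      ((3 : ℝ≥0) : ℝ≥0∞) * eLpNorm (laplacian w) 4 volume := by
  have h4 := h 4 (by norm_num) (by simp) w hw j k
  have hmax : max ((4 : ℝ≥0∞).toReal - 1) ((4 : ℝ≥0∞).toReal - 1)⁻¹ = 3 := by norm_num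
  rw [hmax] at h4
  have h3 : ENNReal.ofReal 3 = ((3 : ℝ≥0) : ℝ≥0∞) := by
    rw [show (3 : ℝ) = ((3 : ℝ≥0) : ℝ) by norm_num, ENNReal.ofReal_coe_nnreal]
  rwa [h3] at h4

end Consequences

/-! ## 2. The lower bound for `R₂² − R₁²` on `𝕋²` -/

/-- **Sharp lower bound for the real part of the Beurling–Ahlfors transform, periodic form** (named
fact, nothing asserted): for `1 < p < ∞` the operator `R₂² − R₁² = -(∂₁² − ∂₂²)Δ⁻¹` has norm at least
`p* − 1 = max {p − 1, (p − 1)⁻¹}` on the mean-zero subspace `L^p_0(𝕋²)`; unpacked on the dense smooth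
test class (`Δψ`, `ψ` a trigonometric polynomial, exhaust the mean-zero trigonometric polynomials):
for every `c < p* − 1` there is a smooth real `ψ` on `𝕋²` with `‖Δψ‖_p ≠ 0` and
`c ‖Δψ‖_{L^p(𝕋²)} ≤ ‖∂₀∂₀ψ − ∂₁∂₁ψ‖_{L^p(𝕋²)}`. In print: `‖Re 𝔅‖_{L^p(ℝ²)→L^p(ℝ²)} = p* − 1`,
`Re 𝔅 = R₂² − R₁²` (Geiss–Montgomery-Smith–Saksman 2010, Cor. 1.1; the lower bound is the novelty
there, the upper bound is Nazarov–Volberg 2003), equal to the `L^p_0(𝕋²)` norm by their Lemma 2.2.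
The statement is false for any constant above `p* − 1` (by the same corollary). Its `p = 4`
fourth-power form is `secondRiesz_box_laplacian_lower_sharp.quartic` below.
[cite: GeissMontgomerySmithSaksman2010, Cor. 1.1 and Lemma 2.2] -/
def secondRiesz_box_laplacian_lower_sharp : Prop :=
  ∀ (p : ℝ≥0∞), 1 < p → p < (⊤ : ℝ≥0∞) → ∀ c : ℝ, c < max (p.toReal - 1) (p.toReal - 1)⁻¹ →
    ∃ ψ : UnitAddTorus (Fin 2) → ℝ, IsSmooth ψ ∧ eLpNorm (laplacian ψ) p volume ≠ 0 ∧
      ENNReal.ofReal c * eLpNorm (laplacian ψ) p volume ≤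
        eLpNorm (fun y => partialDeriv 0 (partialDeriv 0 ψ) y - partialDeriv 1 (partialDeriv 1 ψ) y)
          p volume

section Quartic

/-- For a continuous real function on `T^d`, `‖g‖_{L⁴} = ENNReal.ofReal ((∫ g⁴)^{1/4})`. [folklore] -/
private theorem eLpNorm_four_eq_ofReal_of_continuous {g : UnitAddTorus d → ℝ} (hg : Continuous g) :
    eLpNorm g 4 volume = ENNReal.ofReal ((∫ x, (g x) ^ 4) ^ (1 / 4 : ℝ)) := by
  have hmem : MemLp g 4 volume := hg.memLp_of_hasCompactSupport (HasCompactSupport.of_compactSpace g)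
  rw [hmem.eLpNorm_eq_integral_rpow_norm (by norm_num) (by simp)]
  have h4 : (4 : ℝ≥0∞).toReal = 4 := by norm_num
  rw [h4, one_div]
  congr 2
  refine integral_congr_ae (Filter.Eventually.of_forall fun x => ?_)
  simp only [Real.norm_eq_abs]
  rw [show (4 : ℝ) = ((4 : ℕ) : ℝ) by norm_num, Real.rpow_natCast, pow_abs]
  exact abs_of_nonneg (by positivity)

/-- **The `L⁴` instance in fourth-power form** — the shape of the hypothesis
`SecondRieszQuarticLower 3` of the NS functional-mining cell: for every `c < 81 = 3⁴` there is a
smooth real `ψ` on `𝕋²` with `0 < ∫(Δψ)⁴` and `c ∫(Δψ)⁴ ≤ ∫(∂₀∂₀ψ − ∂₁∂₁ψ)⁴`, where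
`Δψ = ∂₀∂₀ψ + ∂₁∂₁ψ`. [cite: GeissMontgomerySmithSaksman2010, Cor. 1.1 and Lemma 2.2] -/
theorem secondRiesz_box_laplacian_lower_sharp.quartic (h : secondRiesz_box_laplacian_lower_sharp)
    (c : ℝ) (hc : c < 3 ^ 4) :
    ∃ ψ : UnitAddTorus (Fin 2) → ℝ, IsSmooth ψ ∧
      0 < ∫ y, (partialDeriv 0 (partialDeriv 0 ψ) y + partialDeriv 1 (partialDeriv 1 ψ) y) ^ 4 ∧
      c * ∫ y, (partialDeriv 0 (partialDeriv 0 ψ) y + partialDeriv 1 (partialDeriv 1 ψ) y) ^ 4 ≤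
        ∫ y, (partialDeriv 0 (partialDeriv 0 ψ) y - partialDeriv 1 (partialDeriv 1 ψ) y) ^ 4 := by
  classical
  -- reduce to `0 ≤ c' := max c 0 < 81` and `a := c'^{1/4} < 3`
  set c' : ℝ := max c 0 with hc'
  have hc'0 : 0 ≤ c' := le_max_right _ _
  have hc'81 : c' < 3 ^ 4 := max_lt hc (by norm_num)
  set a : ℝ := c' ^ (1 / 4 : ℝ) with ha
  have ha0 : 0 ≤ a := Real.rpow_nonneg hc'0 _
  have ha3 : a < 3 := by
    have h81 : (3 : ℝ) ^ 4 = 81 := by norm_num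
    have : c' ^ (1 / 4 : ℝ) < (81 : ℝ) ^ (1 / 4 : ℝ) :=
      Real.rpow_lt_rpow hc'0 (h81 ▸ hc'81) (by norm_num)
    have h3 : (81 : ℝ) ^ (1 / 4 : ℝ) = 3 := by
      rw [show (81 : ℝ) = 3 ^ (4 : ℝ) by norm_num, ← Real.rpow_mul (by norm_num)]
      norm_num
    rwa [h3] at this
  have ha4 : a ^ 4 = c' := by
    rw [ha, ← Real.rpow_natCast, ← Real.rpow_mul hc'0]
    norm_num
  have hmax : max ((4 : ℝ≥0∞).toReal - 1) ((4 : ℝ≥0∞).toReal - 1)⁻¹ = 3 := by norm_num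
  obtain ⟨ψ, hψ, hne, hle⟩ := h 4 (by norm_num) (by simp) a (hmax ▸ ha3)
  -- names for the two second-order expressions
  set L : UnitAddTorus (Fin 2) → ℝ :=
    fun y => partialDeriv 0 (partialDeriv 0 ψ) y + partialDeriv 1 (partialDeriv 1 ψ) y with hL
  set B : UnitAddTorus (Fin 2) → ℝ :=
    fun y => partialDeriv 0 (partialDeriv 0 ψ) y - partialDeriv 1 (partialDeriv 1 ψ) y with hB
  have hLeq : laplacian ψ = L := by
    funext y
    rw [laplacian_eq_sum_partialDeriv_partialDeriv hψ, Fin.sum_univ_two]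
  have hcont2 : ∀ i j : Fin 2, Continuous (partialDeriv i (partialDeriv j ψ)) :=
    fun i j => ((hψ.partialDeriv j).partialDeriv i).continuous
  have hLc : Continuous L := (hcont2 0 0).add (hcont2 1 1)
  have hBc : Continuous B := (hcont2 0 0).sub (hcont2 1 1)
  have hIL0 : 0 ≤ ∫ y, L y ^ 4 := integral_nonneg fun y => by positivity
  have hIB0 : 0 ≤ ∫ y, B y ^ 4 := integral_nonneg fun y => by positivity
  rw [hLeq, eLpNorm_four_eq_ofReal_of_continuous hLc] at hne hle
  have hBn : eLpNorm B 4 volume = ENNReal.ofReal ((∫ y, B y ^ 4) ^ (1 / 4 : ℝ)) :=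
    eLpNorm_four_eq_ofReal_of_continuous hBc
  rw [hBn] at hle
  -- positivity of `∫ L⁴`
  have hILpos : 0 < ∫ y, L y ^ 4 := by
    rcases hIL0.lt_or_eq with hpos | hzero
    · exact hpos
    · exfalso
      apply hne
      rw [← hzero, Real.zero_rpow (by norm_num), ENNReal.ofReal_zero]
  -- the real inequality `a (∫L⁴)^{1/4} ≤ (∫B⁴)^{1/4}`, raised to the fourth power
  have hreal : a * (∫ y, L y ^ 4) ^ (1 / 4 : ℝ) ≤ (∫ y, B y ^ 4) ^ (1 / 4 : ℝ) := by
    rw [← ENNReal.ofReal_mul ha0] at hle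
    exact (ENNReal.ofReal_le_ofReal_iff (Real.rpow_nonneg hIB0 _)).1 hle
  have hpow : (a * (∫ y, L y ^ 4) ^ (1 / 4 : ℝ)) ^ 4 ≤ ((∫ y, B y ^ 4) ^ (1 / 4 : ℝ)) ^ 4 :=
    pow_le_pow_left₀ (mul_nonneg ha0 (Real.rpow_nonneg hIL0 _)) hreal 4
  have hroot : ∀ {t : ℝ}, 0 ≤ t → (t ^ (1 / 4 : ℝ)) ^ 4 = t := fun {t} ht => by
    rw [← Real.rpow_natCast, ← Real.rpow_mul ht]
    norm_num
  rw [mul_pow, hroot hIL0, hroot hIB0, ha4] at hpow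
  refine ⟨ψ, hψ, hILpos, le_trans ?_ hpow⟩
  exact mul_le_mul_of_nonneg_right (le_max_left _ _) hIL0

end Quartic

end Torus

end Literature.Analysis.FunctionSpaces

end
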